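import Summits.QuantumFields.YangMills.Theorems.UnitScaleGibbsActionDerivativeGaussianDomination
import Literature.MathematicalPhysics.QuantumFieldTheory.Balaban1983to89.T3UnitLawGaugeInvariance
import Literature.MathematicalPhysics.QuantumFieldTheory.Balaban1983to89.T4AxialGaugeFixing
import HarnessLib

/-!
# Gauge covariance of the slot letters and ELITZUR ORTHOGONALITY for the double-insertion words `word₂`: off-diagonal second insertions at
# DISTINCT vertices have mean zero under Bałaban's unit-scale Gibbs measure — exactly, at every `β ≥ 0`

Cell `ym3-torus` (rung R3 = continuum SU(2) Yang–Mills on T³ — NOT d = 4, NOT infinite volume, NOT a mass gap, NOT Clay); width seat `ym3-torus-px17` gen 7; row (E2)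
of the split of record with `ym-ust-19936-w8` g10 (2026-08-29 19:21Z: (Q)(E0)(G)(E1) = w8's `UnitScaleGibbsElitzurOrthogonality`, (E2) = this file), for the
repair of LINE 28 «GrossTransfer» (`stub_linTest`, stmt-QuantumFields-23083) after the NET-FLUX finding: in a RAW region the Hessian observable `actionDeriv₂ ρ v` has
mean equal to its diagonal (mass) part plus the same-vertex corner terms — insertions at distinct lattice sites decorrelate (Elitzur's theorem, finite form).

WHAT IS PROVED (ns `…Theorems.UnitScaleGibbsWordTwoElitzur`; THEOREMS ONLY, 0 `def`, 0 `sorry`; letters of ✓ `UnitScaleGibbsActionDerivativeSlotCalculus`):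
* §1 GAUGE COVARIANCE under an ARBITRARY `v : GaugeTransf` (matrix model `ρ : G →* M_N(ℂ)`), corners `c = (x, x+e_μ, x+e_μ+e_ν, x+e_ν, x)`, ADJOINT-ROTATED
  LETTER `ũ b = ρ((v b₋)⁻¹)·u b·ρ(v b₋)`: `slot_gaugeAct`, `slotIns_gaugeAct`, `slotIns₂_gaugeAct` (`letter_k(U^v) = ρ(v c_k)·letter_k(U; ũ)·ρ(v c_{k+1})⁻¹`),
  `word_telescope` ⇒ ★ `wordIns_gaugeAct` / ★★ `word₂_gaugeAct` (`word₂ ρ u (U^v) p i l = ρ(v x)·word₂ ρ ũ U p i l·ρ((v x)⁻¹)`), the trace forms, and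
  ★ `actionDeriv_gaugeAct` / ★ `actionDeriv₂_gaugeAct`: `(∂_u A)(U^v) = (∂_ũ A)(U)`, `(∂_u∂_u A)(U^v) = (∂_ũ∂_ũ A)(U)`.
* §2 LETTER CALCULUS: `slotIns_congr` (locality at `slotBond p k`), `slotIns_add`/`slotIns_sum`/`slotIns_zero'`, `word_update_add`/`word_update_sum`.
* §3 ★★★ `integral_re_trace_word₂_eq_zero_of_twirl` — ELITZUR ORTHOGONALITY, ABSTRACT FINITE TWIRL: a finite family `g : Fin n → G` with
  `Σ_k ρ(g k)⁻¹·u(slotBond p i)·ρ(g k) = 0` and `(slotBond p i).src ≠ (slotBond p l).src` give `∫ Re tr(word₂ ρ u U p i l) dμ_β = 0` (invariance of `μ_β` under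
  the site rotations `siteTransf y (g k)`, lit ✓ `T3UnitLawGaugeInvariance.expect_gaugeAct`; §1: each rotation conjugates ONLY the slot-`i` letter; §2: the rotated
  words sum to the word with the zero letter).  The `SU(2)` instance (unit quaternions, `X + Σ_k q_k⁻¹Xq_k = 2 tr X·1`) is w8's (Q), applied in the sequel.

HONEST SCOPE.  Exact finite-`β` identities; helper rows toward a REDESIGN of `stub_linTest` not yet registered; NOTHING of `stub_linTest`, 23083, K1, `HistoryTailL`
or any rung/summit statement is proved; the Yang–Mills mass gap is NOT proved.  `--supports stmt-QuantumFields-23083 --as helper`.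
References: S. Elitzur, Phys. Rev. D 12 (1975) 3978 [Elitzur1975]; M. Creutz, Quarks, gluons and lattices, Ch. 9, 11 [Creutz2022]; L. Gross, CMP 92 (1983) Thm 2.2 [GrossCMP1983].
-/

set_option autoImplicit false

noncomputable section
open MeasureTheory
open scoped BigOperators
open Literature.MathematicalPhysics.QuantumFieldTheory.Balaban1983to89
open Literature.MathematicalPhysics.QuantumFieldTheory.Balaban1983to89.T4GenFunBounds (gibbsMeasure isProbabilityMeasure_gibbsMeasure
  integral_gibbsMeasure_eq_expect)
open Literature.MathematicalPhysics.QuantumFieldTheory.Balaban1983to89.T3UnitLawGaugeInvariance (expect_gaugeAct map_gaugeAct_gibbsMeasure)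
open Literature.MathematicalPhysics.QuantumFieldTheory.Balaban1983to89.T4AxialGaugeFixing (siteTransf gaugeAct_siteTransf_apply)
open Summit.QuantumFields.YangMills.Theorems.UnitScaleGibbsActionDerivativeSlotCalculus

namespace Summit.QuantumFields.YangMills.Theorems.UnitScaleGibbsWordTwoElitzur

/-! ## §1 Gauge covariance of the slot letters, the words, and the Schwinger–Dyson observables -/

section Covariance

variable {N : ℕ} {P : Params} {j : ℕ} {G : Type} [GaugeGroup G]
  (ρ : G →* Matrix (Fin N) (Fin N) ℂ) (u : PBond P j → Matrix (Fin N) (Fin N) ℂ) (v : GaugeTransf P j G)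

omit [GaugeGroup G] in
/-- The far corner of a plaquette does not depend on the order of the two steps. [folklore] -/
private theorem shift_shift_comm (x : Site P j) (μ ν : Fin P.d) : (x.shift μ).shift ν = (x.shift ν).shift μ := by
  funext κ
  by_cases h1 : κ = ν
  · subst h1
    by_cases h2 : κ = μ
    · subst h2; rfl
    · simp [Site.shift, Function.update_of_ne h2]
  · by_cases h2 : κ = μ
    · subst h2
      simp [Site.shift, Function.update_of_ne h1]
    · simp [Site.shift, Function.update_of_ne h1, Function.update_of_ne h2]

/-- `ρ(a)·(ρ(a⁻¹)·M) = M`. [folklore] -/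
private theorem rho_mul_rho_inv_mul (a : G) (M : Matrix (Fin N) (Fin N) ℂ) : ρ a * (ρ a⁻¹ * M) = M := by
  rw [← mul_assoc, ← map_mul, mul_inv_cancel, map_one, one_mul]

/-- `ρ(a⁻¹)·(ρ(a)·M) = M`. [folklore] -/
private theorem rho_inv_mul_rho_mul (a : G) (M : Matrix (Fin N) (Fin N) ℂ) : ρ a⁻¹ * (ρ a * M) = M := by
  rw [← mul_assoc, ← map_mul, inv_mul_cancel, map_one, one_mul]

/-- `ρ(a)·ρ(a⁻¹) = 1`. [folklore] -/
private theorem rho_mul_rho_inv (a : G) : ρ a * ρ a⁻¹ = 1 := by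
  rw [← map_mul, mul_inv_cancel, map_one]

/-- `ρ(a⁻¹)·ρ(a) = 1`. [folklore] -/
private theorem rho_inv_mul_rho (a : G) : ρ a⁻¹ * ρ a = 1 := by
  rw [← map_mul, inv_mul_cancel, map_one]

/-- ★ **Gauge covariance of the four slots**: `slot_k(U^v) = ρ(v c_k)·slot_k(U)·ρ(v c_{k+1})⁻¹` with the corners `c = (x, x+e_μ, x+e_μ+e_ν, x+e_ν, x)`
of the plaquette (`U^v(b) = v(b₋) U(b) v(b₊)⁻¹`). [cite: Creutz2022, Ch. 9] -/
theorem slot_gaugeAct (U : GaugeField P j G) (p : Plaq P j) :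
    slot ρ (GaugeField.gaugeAct v U) p = fun k =>
      ρ (v (![p.src, p.src.shift p.μ, (p.src.shift p.μ).shift p.ν, p.src.shift p.ν] k)) * slot ρ U p k *
        ρ ((v (![p.src.shift p.μ, (p.src.shift p.μ).shift p.ν, p.src.shift p.ν, p.src] k))⁻¹) := by
  funext k
  fin_cases k
  · show ρ (GaugeField.gaugeAct v U ⟨p.src, p.μ⟩) = ρ (v p.src) * ρ (U ⟨p.src, p.μ⟩) * ρ ((v (p.src.shift p.μ))⁻¹)
    simp only [GaugeField.gaugeAct, PBond.tgt, map_mul]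
  · show ρ (GaugeField.gaugeAct v U ⟨p.src.shift p.μ, p.ν⟩) =
      ρ (v (p.src.shift p.μ)) * ρ (U ⟨p.src.shift p.μ, p.ν⟩) * ρ ((v ((p.src.shift p.μ).shift p.ν))⁻¹)
    simp only [GaugeField.gaugeAct, PBond.tgt, map_mul]
  · show ρ ((GaugeField.gaugeAct v U ⟨p.src.shift p.ν, p.μ⟩)⁻¹) =
      ρ (v ((p.src.shift p.μ).shift p.ν)) * ρ ((U ⟨p.src.shift p.ν, p.μ⟩)⁻¹) * ρ ((v (p.src.shift p.ν))⁻¹)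
    simp only [GaugeField.gaugeAct, PBond.tgt, shift_shift_comm p.src p.ν p.μ, mul_inv_rev, inv_inv, map_mul, mul_assoc]
  · show ρ ((GaugeField.gaugeAct v U ⟨p.src, p.ν⟩)⁻¹) = ρ (v (p.src.shift p.ν)) * ρ ((U ⟨p.src, p.ν⟩)⁻¹) * ρ ((v p.src)⁻¹)
    simp only [GaugeField.gaugeAct, PBond.tgt, mul_inv_rev, inv_inv, map_mul, mul_assoc]

/-- ★ **Gauge covariance of the first insertions**, with the letter rotated by the adjoint action at its source vertex:
`slotIns_k(U^v; u) = ρ(v c_k)·slotIns_k(U; ũ)·ρ(v c_{k+1})⁻¹`, `ũ b = ρ((v b₋)⁻¹) u b ρ(v b₋)`. [cite: Creutz2022, Ch. 11] -/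
theorem slotIns_gaugeAct (U : GaugeField P j G) (p : Plaq P j) :
    slotIns ρ u (GaugeField.gaugeAct v U) p = fun k =>
      ρ (v (![p.src, p.src.shift p.μ, (p.src.shift p.μ).shift p.ν, p.src.shift p.ν] k)) *
        slotIns ρ (fun b => ρ ((v b.src)⁻¹) * u b * ρ (v b.src)) U p k *
        ρ ((v (![p.src.shift p.μ, (p.src.shift p.μ).shift p.ν, p.src.shift p.ν, p.src] k))⁻¹) := by
  funext k
  fin_cases k
  · show u ⟨p.src, p.μ⟩ * ρ (GaugeField.gaugeAct v U ⟨p.src, p.μ⟩) =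
      ρ (v p.src) * (ρ ((v p.src)⁻¹) * u ⟨p.src, p.μ⟩ * ρ (v p.src) * ρ (U ⟨p.src, p.μ⟩)) * ρ ((v (p.src.shift p.μ))⁻¹)
    simp only [GaugeField.gaugeAct, PBond.tgt, map_mul, mul_assoc, rho_mul_rho_inv_mul]
  · show u ⟨p.src.shift p.μ, p.ν⟩ * ρ (GaugeField.gaugeAct v U ⟨p.src.shift p.μ, p.ν⟩) =
      ρ (v (p.src.shift p.μ)) * (ρ ((v (p.src.shift p.μ))⁻¹) * u ⟨p.src.shift p.μ, p.ν⟩ * ρ (v (p.src.shift p.μ)) *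
        ρ (U ⟨p.src.shift p.μ, p.ν⟩)) * ρ ((v ((p.src.shift p.μ).shift p.ν))⁻¹)
    simp only [GaugeField.gaugeAct, PBond.tgt, map_mul, mul_assoc, rho_mul_rho_inv_mul]
  · show ρ ((GaugeField.gaugeAct v U ⟨p.src.shift p.ν, p.μ⟩)⁻¹) * (-u ⟨p.src.shift p.ν, p.μ⟩) =
      ρ (v ((p.src.shift p.μ).shift p.ν)) * (ρ ((U ⟨p.src.shift p.ν, p.μ⟩)⁻¹) *
        (-(ρ ((v (p.src.shift p.ν))⁻¹) * u ⟨p.src.shift p.ν, p.μ⟩ * ρ (v (p.src.shift p.ν))))) * ρ ((v (p.src.shift p.ν))⁻¹)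
    simp only [GaugeField.gaugeAct, PBond.tgt, shift_shift_comm p.src p.ν p.μ, mul_inv_rev, inv_inv, map_mul, mul_assoc, mul_neg, neg_mul,
      rho_mul_rho_inv, mul_one]
  · show ρ ((GaugeField.gaugeAct v U ⟨p.src, p.ν⟩)⁻¹) * (-u ⟨p.src, p.ν⟩) =
      ρ (v (p.src.shift p.ν)) * (ρ ((U ⟨p.src, p.ν⟩)⁻¹) * (-(ρ ((v p.src)⁻¹) * u ⟨p.src, p.ν⟩ * ρ (v p.src)))) * ρ ((v p.src)⁻¹)
    simp only [GaugeField.gaugeAct, PBond.tgt, mul_inv_rev, inv_inv, map_mul, mul_assoc, mul_neg, neg_mul, rho_mul_rho_inv, mul_one]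

/-- ★ **Gauge covariance of the second insertions** (the same slot differentiated twice). [cite: Creutz2022, Ch. 11] -/
theorem slotIns₂_gaugeAct (U : GaugeField P j G) (p : Plaq P j) :
    slotIns₂ ρ u (GaugeField.gaugeAct v U) p = fun k =>
      ρ (v (![p.src, p.src.shift p.μ, (p.src.shift p.μ).shift p.ν, p.src.shift p.ν] k)) *
        slotIns₂ ρ (fun b => ρ ((v b.src)⁻¹) * u b * ρ (v b.src)) U p k *
        ρ ((v (![p.src.shift p.μ, (p.src.shift p.μ).shift p.ν, p.src.shift p.ν, p.src] k))⁻¹) := by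
  funext k
  fin_cases k
  · show u ⟨p.src, p.μ⟩ * (u ⟨p.src, p.μ⟩ * ρ (GaugeField.gaugeAct v U ⟨p.src, p.μ⟩)) =
      ρ (v p.src) * (ρ ((v p.src)⁻¹) * u ⟨p.src, p.μ⟩ * ρ (v p.src) *
        (ρ ((v p.src)⁻¹) * u ⟨p.src, p.μ⟩ * ρ (v p.src) * ρ (U ⟨p.src, p.μ⟩))) * ρ ((v (p.src.shift p.μ))⁻¹)
    simp only [GaugeField.gaugeAct, PBond.tgt, map_mul, mul_assoc, rho_mul_rho_inv_mul]
  · show u ⟨p.src.shift p.μ, p.ν⟩ * (u ⟨p.src.shift p.μ, p.ν⟩ * ρ (GaugeField.gaugeAct v U ⟨p.src.shift p.μ, p.ν⟩)) =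
      ρ (v (p.src.shift p.μ)) * (ρ ((v (p.src.shift p.μ))⁻¹) * u ⟨p.src.shift p.μ, p.ν⟩ * ρ (v (p.src.shift p.μ)) *
        (ρ ((v (p.src.shift p.μ))⁻¹) * u ⟨p.src.shift p.μ, p.ν⟩ * ρ (v (p.src.shift p.μ)) * ρ (U ⟨p.src.shift p.μ, p.ν⟩))) *
        ρ ((v ((p.src.shift p.μ).shift p.ν))⁻¹)
    simp only [GaugeField.gaugeAct, PBond.tgt, map_mul, mul_assoc, rho_mul_rho_inv_mul]
  · show ρ ((GaugeField.gaugeAct v U ⟨p.src.shift p.ν, p.μ⟩)⁻¹) * (-u ⟨p.src.shift p.ν, p.μ⟩) * (-u ⟨p.src.shift p.ν, p.μ⟩) =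
      ρ (v ((p.src.shift p.μ).shift p.ν)) * (ρ ((U ⟨p.src.shift p.ν, p.μ⟩)⁻¹) *
        (-(ρ ((v (p.src.shift p.ν))⁻¹) * u ⟨p.src.shift p.ν, p.μ⟩ * ρ (v (p.src.shift p.ν)))) *
        (-(ρ ((v (p.src.shift p.ν))⁻¹) * u ⟨p.src.shift p.ν, p.μ⟩ * ρ (v (p.src.shift p.ν))))) * ρ ((v (p.src.shift p.ν))⁻¹)
    simp only [GaugeField.gaugeAct, PBond.tgt, shift_shift_comm p.src p.ν p.μ, mul_inv_rev, inv_inv, map_mul, mul_assoc, mul_neg, neg_mul,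
      neg_neg, rho_mul_rho_inv, rho_mul_rho_inv_mul, mul_one]
  · show ρ ((GaugeField.gaugeAct v U ⟨p.src, p.ν⟩)⁻¹) * (-u ⟨p.src, p.ν⟩) * (-u ⟨p.src, p.ν⟩) =
      ρ (v (p.src.shift p.ν)) * (ρ ((U ⟨p.src, p.ν⟩)⁻¹) * (-(ρ ((v p.src)⁻¹) * u ⟨p.src, p.ν⟩ * ρ (v p.src))) *
        (-(ρ ((v p.src)⁻¹) * u ⟨p.src, p.ν⟩ * ρ (v p.src)))) * ρ ((v p.src)⁻¹)
    simp only [GaugeField.gaugeAct, PBond.tgt, mul_inv_rev, inv_inv, map_mul, mul_assoc, mul_neg, neg_mul, neg_neg, rho_mul_rho_inv,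
      rho_mul_rho_inv_mul, mul_one]

omit [GaugeGroup G] in
/-- **Telescoping of a conjugated word**: if `B_k·A_{k+1} = 1` for `k = 0, 1, 2` then `word(A_k T_k B_k) = A₀·word(T)·B₃`. [folklore] -/
theorem word_telescope (A T B : Fin 4 → Matrix (Fin N) (Fin N) ℂ) (h01 : B 0 * A 1 = 1) (h12 : B 1 * A 2 = 1) (h23 : B 2 * A 3 = 1) :
    word (fun k => A k * T k * B k) = A 0 * word T * B 3 := by
  simp only [word]
  calc A 0 * T 0 * B 0 * (A 1 * T 1 * B 1) * (A 2 * T 2 * B 2) * (A 3 * T 3 * B 3)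
      = A 0 * T 0 * (B 0 * A 1) * T 1 * (B 1 * A 2) * T 2 * (B 2 * A 3) * T 3 * B 3 := by noncomm_ring
    _ = A 0 * (T 0 * T 1 * T 2 * T 3) * B 3 := by rw [h01, h12, h23]; noncomm_ring

/-- ★★ **Gauge covariance of the double-insertion words**: `word₂ ρ u (U^v) p i l = ρ(v x)·word₂ ρ ũ U p i l·ρ((v x)⁻¹)`, `x = p.src`, all sixteen `(i, l)`.
[cite: Creutz2022, Ch. 11] -/
theorem word₂_gaugeAct (U : GaugeField P j G) (p : Plaq P j) (i l : Fin 4) :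
    word₂ ρ u (GaugeField.gaugeAct v U) p i l =
      ρ (v p.src) * word₂ ρ (fun b => ρ ((v b.src)⁻¹) * u b * ρ (v b.src)) U p i l * ρ ((v p.src)⁻¹) := by
  set c : Fin 4 → Site P j := ![p.src, p.src.shift p.μ, (p.src.shift p.μ).shift p.ν, p.src.shift p.ν] with hc
  set c' : Fin 4 → Site P j := ![p.src.shift p.μ, (p.src.shift p.μ).shift p.ν, p.src.shift p.ν, p.src] with hc'
  set ut : PBond P j → Matrix (Fin N) (Fin N) ℂ := fun b => ρ ((v b.src)⁻¹) * u b * ρ (v b.src) with hut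
  have hS : Function.update (Function.update (slot ρ (GaugeField.gaugeAct v U) p) i (slotIns ρ u (GaugeField.gaugeAct v U) p i)) l
        (if l = i then slotIns₂ ρ u (GaugeField.gaugeAct v U) p i else slotIns ρ u (GaugeField.gaugeAct v U) p l) =
      fun k => ρ (v (c k)) *
        Function.update (Function.update (slot ρ U p) i (slotIns ρ ut U p i)) l
          (if l = i then slotIns₂ ρ ut U p i else slotIns ρ ut U p l) k * ρ ((v (c' k))⁻¹) := by
    funext k
    by_cases hkl : k = l
    · subst hkl
      simp only [Function.update_self]
      split_ifs with h
      · subst h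
        exact congrFun (slotIns₂_gaugeAct ρ u v U p) k
      · exact congrFun (slotIns_gaugeAct ρ u v U p) k
    · simp only [Function.update_of_ne hkl]
      by_cases hki : k = i
      · subst hki
        simp only [Function.update_self]
        exact congrFun (slotIns_gaugeAct ρ u v U p) k
      · simp only [Function.update_of_ne hki]
        exact congrFun (slot_gaugeAct ρ v U p) k
  unfold word₂
  rw [hS, word_telescope]
  · rfl
  · show ρ ((v (p.src.shift p.μ))⁻¹) * ρ (v (p.src.shift p.μ)) = 1
    exact rho_inv_mul_rho ρ _
  · show ρ ((v ((p.src.shift p.μ).shift p.ν))⁻¹) * ρ (v ((p.src.shift p.μ).shift p.ν)) = 1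
    exact rho_inv_mul_rho ρ _
  · show ρ ((v (p.src.shift p.ν))⁻¹) * ρ (v (p.src.shift p.ν)) = 1
    exact rho_inv_mul_rho ρ _

/-- ★ **Gauge covariance of the single-insertion words** `word(slot[i ↦ slotIns i])` (the letters of `actionDeriv`). [cite: Creutz2022, Ch. 11] -/
theorem wordIns_gaugeAct (U : GaugeField P j G) (p : Plaq P j) (i : Fin 4) :
    word (Function.update (slot ρ (GaugeField.gaugeAct v U) p) i (slotIns ρ u (GaugeField.gaugeAct v U) p i)) =
      ρ (v p.src) * word (Function.update (slot ρ U p) i (slotIns ρ (fun b => ρ ((v b.src)⁻¹) * u b * ρ (v b.src)) U p i)) *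
        ρ ((v p.src)⁻¹) := by
  set c : Fin 4 → Site P j := ![p.src, p.src.shift p.μ, (p.src.shift p.μ).shift p.ν, p.src.shift p.ν] with hc
  set c' : Fin 4 → Site P j := ![p.src.shift p.μ, (p.src.shift p.μ).shift p.ν, p.src.shift p.ν, p.src] with hc'
  set ut : PBond P j → Matrix (Fin N) (Fin N) ℂ := fun b => ρ ((v b.src)⁻¹) * u b * ρ (v b.src) with hut
  have hS : Function.update (slot ρ (GaugeField.gaugeAct v U) p) i (slotIns ρ u (GaugeField.gaugeAct v U) p i) =
      fun k => ρ (v (c k)) * Function.update (slot ρ U p) i (slotIns ρ ut U p i) k * ρ ((v (c' k))⁻¹) := by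
    funext k
    by_cases hki : k = i
    · subst hki
      simp only [Function.update_self]
      exact congrFun (slotIns_gaugeAct ρ u v U p) k
    · simp only [Function.update_of_ne hki]
      exact congrFun (slot_gaugeAct ρ v U p) k
  rw [hS, word_telescope]
  · rfl
  · show ρ ((v (p.src.shift p.μ))⁻¹) * ρ (v (p.src.shift p.μ)) = 1
    exact rho_inv_mul_rho ρ _
  · show ρ ((v ((p.src.shift p.μ).shift p.ν))⁻¹) * ρ (v ((p.src.shift p.μ).shift p.ν)) = 1
    exact rho_inv_mul_rho ρ _
  · show ρ ((v (p.src.shift p.ν))⁻¹) * ρ (v (p.src.shift p.ν)) = 1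
    exact rho_inv_mul_rho ρ _

/-- The trace of a double-insertion word is gauge INVARIANT once the letter is rotated: `tr word₂ ρ u (U^v) p i l = tr word₂ ρ ũ U p i l`.
[cite: Creutz2022, Ch. 11] -/
theorem trace_word₂_gaugeAct (U : GaugeField P j G) (p : Plaq P j) (i l : Fin 4) :
    (word₂ ρ u (GaugeField.gaugeAct v U) p i l).trace = (word₂ ρ (fun b => ρ ((v b.src)⁻¹) * u b * ρ (v b.src)) U p i l).trace := by
  rw [word₂_gaugeAct, Matrix.trace_mul_cycle, rho_inv_mul_rho, one_mul]

/-- The trace of a single-insertion word is gauge invariant once the letter is rotated. [cite: Creutz2022, Ch. 11] -/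
theorem trace_wordIns_gaugeAct (U : GaugeField P j G) (p : Plaq P j) (i : Fin 4) :
    (word (Function.update (slot ρ (GaugeField.gaugeAct v U) p) i (slotIns ρ u (GaugeField.gaugeAct v U) p i))).trace =
      (word (Function.update (slot ρ U p) i (slotIns ρ (fun b => ρ ((v b.src)⁻¹) * u b * ρ (v b.src)) U p i))).trace := by
  rw [wordIns_gaugeAct, Matrix.trace_mul_cycle, rho_inv_mul_rho, one_mul]

/-- ★ **The Schwinger–Dyson observable is gauge covariant**: `(∂_u A)(U^v) = (∂_ũ A)(U)`. [cite: GrossCMP1983, Thm 2.2 (proof)] -/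
theorem actionDeriv_gaugeAct (U : GaugeField P j G) :
    actionDeriv ρ u (GaugeField.gaugeAct v U) = actionDeriv ρ (fun b => ρ ((v b.src)⁻¹) * u b * ρ (v b.src)) U := by
  unfold actionDeriv
  simp only [trace_wordIns_gaugeAct]

/-- ★ **The Hessian observable is gauge covariant**: `(∂_u ∂_u A)(U^v) = (∂_ũ ∂_ũ A)(U)`. [cite: GrossCMP1983, Thm 2.2 (proof)] -/
theorem actionDeriv₂_gaugeAct (U : GaugeField P j G) :
    actionDeriv₂ ρ u (GaugeField.gaugeAct v U) = actionDeriv₂ ρ (fun b => ρ ((v b.src)⁻¹) * u b * ρ (v b.src)) U := by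
  unfold actionDeriv₂
  simp only [trace_word₂_gaugeAct]

end Covariance

/-! ## §2 Letter calculus: locality and additivity of the insertions -/

section Letters

variable {N : ℕ} {P : Params} {j : ℕ} {G : Type} [GaugeGroup G]
  (ρ : G →* Matrix (Fin N) (Fin N) ℂ)

/-- `slotIns_k` reads the letter field only at the bond `slotBond p k`. [folklore] -/
theorem slotIns_congr {u u' : PBond P j → Matrix (Fin N) (Fin N) ℂ} (U : GaugeField P j G) (p : Plaq P j) (k : Fin 4)
    (h : u (slotBond p k) = u' (slotBond p k)) : slotIns ρ u U p k = slotIns ρ u' U p k := by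
  fin_cases k <;> simp_all [slotIns, slotBond]

/-- `slotIns_k` is additive in the letter field. [folklore] -/
theorem slotIns_add (u u' : PBond P j → Matrix (Fin N) (Fin N) ℂ) (U : GaugeField P j G) (p : Plaq P j) (k : Fin 4) :
    slotIns ρ (u + u') U p k = slotIns ρ u U p k + slotIns ρ u' U p k := by
  fin_cases k <;> simp [slotIns, add_mul, mul_add] <;> abel

/-- The zero letter field inserts the zero matrix. [folklore] -/
theorem slotIns_zero' (U : GaugeField P j G) (p : Plaq P j) (k : Fin 4) :
    slotIns ρ (fun _ => (0 : Matrix (Fin N) (Fin N) ℂ)) U p k = 0 := by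
  fin_cases k <;> simp [slotIns]

/-- `slotIns_k` of a finite sum of letter fields is the sum of the insertions. [folklore] -/
theorem slotIns_sum {ι : Type} (s : Finset ι) (u : ι → PBond P j → Matrix (Fin N) (Fin N) ℂ) (U : GaugeField P j G) (p : Plaq P j)
    (k : Fin 4) : slotIns ρ (fun b => ∑ a ∈ s, u a b) U p k = ∑ a ∈ s, slotIns ρ (u a) U p k := by
  classical
  induction s using Finset.induction_on with
  | empty => simpa using slotIns_zero' ρ U p k
  | insert a s ha ih =>
    rw [Finset.sum_insert ha, ← ih, ← slotIns_add]
    congr 1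
    funext b
    rw [Finset.sum_insert ha]
    rfl

omit [GaugeGroup G] in
/-- `word(S[i ↦ ·])` is additive. [folklore] -/
theorem word_update_add (S : Fin 4 → Matrix (Fin N) (Fin N) ℂ) (i : Fin 4) (X Y : Matrix (Fin N) (Fin N) ℂ) :
    word (Function.update S i (X + Y)) = word (Function.update S i X) + word (Function.update S i Y) := by
  fin_cases i <;> simp [word, Function.update_self, Function.update_of_ne, add_mul, mul_add]

omit [GaugeGroup G] in
/-- `word(S[i ↦ Σ_a X_a]) = Σ_a word(S[i ↦ X_a])`. [folklore] -/
theorem word_update_sum {ι : Type} (s : Finset ι) (S : Fin 4 → Matrix (Fin N) (Fin N) ℂ) (i : Fin 4)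
    (X : ι → Matrix (Fin N) (Fin N) ℂ) : word (Function.update S i (∑ a ∈ s, X a)) = ∑ a ∈ s, word (Function.update S i (X a)) := by
  classical
  induction s using Finset.induction_on with
  | empty => simp [word_update_zero]
  | insert a s ha ih => rw [Finset.sum_insert ha, Finset.sum_insert ha, word_update_add, ih]

end Letters

/-! ## §3 Elitzur orthogonality for `word₂` from a finite twirl at the insertion vertex -/

section Twirl

variable {N : ℕ} {P : Params} {G : Type} [GaugeGroup G] [MeasurableSpace G] [HaarData G] [RegularGaugeGroup G]
  (ρ : G →* Matrix (Fin N) (Fin N) ℂ)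

omit [MeasurableSpace G] [HaarData G] [RegularGaugeGroup G] in
/-- Under the site rotation `siteTransf y h` the rotated letter field is `u` off the bonds issuing from `y` and `ρ(h)⁻¹ u_b ρ(h)` on them. [folklore] -/
theorem adLetter_siteTransf (u : PBond P 0 → Matrix (Fin N) (Fin N) ℂ) (y : Site P 0) (h : G) (b : PBond P 0) :
    ρ ((siteTransf y h b.src)⁻¹) * u b * ρ (siteTransf y h b.src) = if b.src = y then ρ h⁻¹ * u b * ρ h else u b := by
  unfold siteTransf
  split_ifs with hb
  · rfl
  · simp

omit [MeasurableSpace G] [HaarData G] [RegularGaugeGroup G] in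
/-- ★ **THE TWIRLED SUM OF THE ROTATED WORDS IS THE WORD WITH THE TWIRLED LETTER**: for slots `i ≠ l` with distinct source vertices and a finite family
`g`, `Σ_k tr word₂ ρ ũ_k U p i l = tr word(S[l ↦ slotIns_l(u)][i ↦ slotIns_i(Σ_k Ad(g_k)⁻¹ u)])`, so it VANISHES when `Σ_k ρ(g k)⁻¹ u_{b_i} ρ(g k) = 0`.
[cite: Elitzur1975, §II] -/
theorem sum_trace_word₂_siteTransf_eq_zero {n : ℕ} (g : Fin n → G) (u : PBond P 0 → Matrix (Fin N) (Fin N) ℂ) (U : GaugeField P 0 G)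
    (p : Plaq P 0) (i l : Fin 4) (hil : (slotBond p i).src ≠ (slotBond p l).src)
    (htw : ∑ k, ρ (g k)⁻¹ * u (slotBond p i) * ρ (g k) = 0) :
    ∑ k, (word₂ ρ (fun b => ρ ((siteTransf (slotBond p i).src (g k) b.src)⁻¹) * u b * ρ (siteTransf (slotBond p i).src (g k) b.src))
      U p i l).trace = 0 := by
  classical
  have hne : l ≠ i := fun h => hil (by rw [h])
  set S := Function.update (slot ρ U p) l (slotIns ρ u U p l) with hS
  -- each rotated word is the word with the slot-`l` letter of `u` and the slot-`i` letter conjugated by `g k`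
  have hk : ∀ k, word₂ ρ (fun b => ρ ((siteTransf (slotBond p i).src (g k) b.src)⁻¹) * u b * ρ (siteTransf (slotBond p i).src (g k) b.src))
      U p i l = word (Function.update S i (slotIns ρ (fun b => ρ (g k)⁻¹ * u b * ρ (g k)) U p i)) := by
    intro k
    have hl : slotIns ρ (fun b => ρ ((siteTransf (slotBond p i).src (g k) b.src)⁻¹) * u b * ρ (siteTransf (slotBond p i).src (g k) b.src))
        U p l = slotIns ρ u U p l :=
      slotIns_congr ρ U p l (by
        show ρ ((siteTransf (slotBond p i).src (g k) (slotBond p l).src)⁻¹) * u (slotBond p l) *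
            ρ (siteTransf (slotBond p i).src (g k) (slotBond p l).src) = u (slotBond p l)
        rw [adLetter_siteTransf, if_neg (Ne.symm hil)])
    have hi : slotIns ρ (fun b => ρ ((siteTransf (slotBond p i).src (g k) b.src)⁻¹) * u b * ρ (siteTransf (slotBond p i).src (g k) b.src))
        U p i = slotIns ρ (fun b => ρ (g k)⁻¹ * u b * ρ (g k)) U p i :=
      slotIns_congr ρ U p i (by
        show ρ ((siteTransf (slotBond p i).src (g k) (slotBond p i).src)⁻¹) * u (slotBond p i) *
            ρ (siteTransf (slotBond p i).src (g k) (slotBond p i).src) = ρ (g k)⁻¹ * u (slotBond p i) * ρ (g k)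
        rw [adLetter_siteTransf, if_pos rfl])
    unfold word₂
    rw [if_neg hne, Function.update_comm hne.symm, hl, hi]
  simp only [hk]
  rw [← Matrix.trace_sum, ← word_update_sum, ← slotIns_sum]
  have h0 : slotIns ρ (fun b => ∑ k, ρ (g k)⁻¹ * u b * ρ (g k)) U p i = slotIns ρ (fun _ => (0 : Matrix (Fin N) (Fin N) ℂ)) U p i :=
    slotIns_congr ρ U p i (by simpa using htw)
  rw [h0, slotIns_zero', word_update_zero, Matrix.trace_zero]

/-- ★★★ **ELITZUR ORTHOGONALITY FOR THE DOUBLE-INSERTION WORDS, ABSTRACT FINITE TWIRL.**  Let `β ≥ 0`, `p` a plaquette, `i, l` slots whose insertion vertices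
`(slotBond p i).src ≠ (slotBond p l).src` differ, and `g : Fin n → G` a finite family conjugation by which kills the slot-`i` letter:
`Σ_k ρ(g k)⁻¹·u(slotBond p i)·ρ(g k) = 0` (for `SU(2)`: `1` and the three unit quaternions, any traceless letter).  If `U ↦ Re tr word₂ ρ u U p i l` is
`μ_β`-integrable then `∫ Re tr(word₂ ρ u U p i l) dμ_β = 0`.  Proof: `μ_β` is invariant under each site rotation `U ↦ U^{siteTransf y (g k)}`,
`y = (slotBond p i).src` (lit ✓ `expect_gaugeAct`), §1 turns the rotated integrand into the word with the conjugated slot-`i` letter (the slot-`l` letter sits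
at another vertex and is untouched), and the `n` rotated integrands sum to zero pointwise (`sum_trace_word₂_siteTransf_eq_zero`). [cite: Elitzur1975, §II] -/
theorem integral_re_trace_word₂_eq_zero_of_twirl {β : ℝ} (hβ : 0 ≤ β) {n : ℕ} (hn : n ≠ 0) (g : Fin n → G)
    (u : PBond P 0 → Matrix (Fin N) (Fin N) ℂ) (p : Plaq P 0) (i l : Fin 4) (hil : (slotBond p i).src ≠ (slotBond p l).src)
    (htw : ∑ k, ρ (g k)⁻¹ * u (slotBond p i) * ρ (g k) = 0)
    (hint : Integrable (fun U : GaugeField P 0 G => (word₂ ρ u U p i l).trace.re) (gibbsMeasure P β)) :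
    ∫ U, (word₂ ρ u U p i l).trace.re ∂gibbsMeasure P β = 0 := by
  classical
  set y := (slotBond p i).src with hy
  set Ψ : GaugeField P 0 G → ℝ := fun U => (word₂ ρ u U p i l).trace.re with hΨ
  -- invariance of `μ_β` under each rotation, for the integrand `Ψ`
  have hinv : ∀ k, ∫ U, Ψ (GaugeField.gaugeAct (siteTransf y (g k)) U) ∂gibbsMeasure P β = ∫ U, Ψ U ∂gibbsMeasure P β := fun k => by
    rw [integral_gibbsMeasure_eq_expect P hβ, integral_gibbsMeasure_eq_expect P hβ]
    exact expect_gaugeAct P β (siteTransf y (g k)) Ψ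
  -- the rotated integrands are integrable (measure-preserving change of variables)
  have hmp : ∀ k, MeasurePreserving (GaugeField.gaugeAct (siteTransf y (g k))) (gibbsMeasure P β) (gibbsMeasure P β) := fun k =>
    ⟨B12RTGaugeInvariance254.measurable_gaugeAct _, map_gaugeAct_gibbsMeasure P hβ _⟩
  have hintk : ∀ k, Integrable (fun U => Ψ (GaugeField.gaugeAct (siteTransf y (g k)) U)) (gibbsMeasure P β) := fun k =>
    ((hmp k).integrable_comp hint.aestronglyMeasurable).mpr hint
  -- pointwise: the rotated integrands sum to zero
  have hpt : ∀ U, ∑ k, Ψ (GaugeField.gaugeAct (siteTransf y (g k)) U) = 0 := fun U => by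
    simp only [hΨ, trace_word₂_gaugeAct]
    rw [← Complex.re_sum, sum_trace_word₂_siteTransf_eq_zero ρ g u U p i l hil htw, Complex.zero_re]
  -- sum the `n` copies of the integral
  have hsum : (n : ℝ) * ∫ U, Ψ U ∂gibbsMeasure P β = 0 := by
    calc (n : ℝ) * ∫ U, Ψ U ∂gibbsMeasure P β = ∑ k : Fin n, ∫ U, Ψ (GaugeField.gaugeAct (siteTransf y (g k)) U) ∂gibbsMeasure P β := by
          simp only [hinv, Finset.sum_const, Finset.card_univ, Fintype.card_fin, nsmul_eq_mul]
      _ = ∫ U, ∑ k : Fin n, Ψ (GaugeField.gaugeAct (siteTransf y (g k)) U) ∂gibbsMeasure P β :=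
          (integral_finsetSum _ fun k _ => hintk k).symm
      _ = 0 := by simp only [hpt, integral_zero]
  have hn' : (n : ℝ) ≠ 0 := by exact_mod_cast hn
  exact (mul_eq_zero.mp hsum).resolve_left hn'

end Twirl

end Summit.QuantumFields.YangMills.Theorems.UnitScaleGibbsWordTwoElitzur
end
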